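import Summits.BirchSwinnertonDyer.BirchSwinnertonDyer.Theorems.UniversalToricDescentBaseLayerDegreeCertificate
import Literature.NumberTheory.EllipticCurves.IwasawaSelmerControlKernelProofs
import HarnessLib

/-!
# Route UniversalToricDescent — the LAYER-`j` DEGREE CERTIFICATE: `#Sel_𝔭^Σ(K_j, E[p^∞])[p] ≤ p^{λ}` at EVERY
# layer `K_j` of the `ℤ_p`-tower (certificate road of the crux idea `degree-only-twin-clause`, utd-idea g25 /
# T10 endorsed by LEAD utd-p2 g15 14:19Z; on ♭B′ stmt-BirchSwinnertonDyer-27401 `TwinWanFrameAtThreeMultTresT` / ♭C₀_T 27173)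

Width seat bsd-wall-utd-p2-w2 g6 (`--supports stmt-BirchSwinnertonDyer-27401`). THEOREMS ONLY (no definition, no
named fact, no `sorry`); BSD is not advanced by this file.

The base-layer certificate of w2 g5 (`UniversalToricDescentBaseLayerDegreeCertificate`, p637731) bounds
`#Sel_𝔭^Σ(K, E[p^∞])[p] ≤ p^n` (`n` = the profile index of a generator of `Ch_Λ(X_ac^Σ)·R₀⟦T⟧`), so an explicit
`p`-descent over `K` exhibiting `p^m` classes certifies the degree clause `m ≤ n` — but only up to the number of
cyclic factors of `X/pX` visible over `K` (utd-idea g25 §2b: tier `m′ = 2` may need the layer `K₁`). This file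
lifts the certificate to every layer `K_j = K̄^{κ⁻¹(p^j ℤ_p)}` (`ZpExtension.layerSubgroup j`), with NO new
definition: the layer Selmer group is the tree's generic `AcSelmer.selmerOver (κ.layerSubgroup j) E[p^∞] p 𝔭 Σ`
(Castella's conditions over `K_j`) and the restriction is the tree's `WeierstrassCurve.layerToInfty κ j`
(`= resOfLe`, Greenberg's `h_j`).

* §1 `layerToInfty_injective_of_fixedPoints_eq_bot`: `h_j : H¹(K_j, E[p^∞]) → H¹(K_∞, E[p^∞])` is INJECTIVE for
  every `j` once `E(K_∞)[p^∞] = 0` — Greenberg's Lemma 3.1 at level `j` (tree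
  `WeierstrassCurve.finite_ker_layerToInfty_and_card_le`: `ker h_j ↪ B/(γ^{p^j} − 1)B`, `B = E(K_∞)[p^∞] = 0`);
  `natCard_torsionBy_selmerLayer_le_of_injective`: then `#Sel_𝔭^Σ(K_j)[p] ≤ #Sel_𝔭^Σ(K_∞)[p]`
  (`resOfLe_mem_selmerOver`: restriction respects Castella's local conditions).
* §2 `natCard_torsionBy_selmerLayer_le_pow_lambdaInvariant`: `E/ℚ` with `E[p]` irreducible, `K` quadratic, ANY
  `ℤ_p`-extension, finite `Σ`, `X_ac^Σ` torsion with `μ = 0` and no non-zero finite `Λ`-submodule ⟹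
  `#Sel_𝔭^Σ(K_j, E[p^∞])[p] ≤ p^{λ(X_ac^Σ)}` for every `j`.
* §3 `natCard_torsionBy_selmerLayer_le_pow_of_generator_normProfile`: the same with `λ` replaced by the route's
  currency, the profile index `n` of any generator of `Ch_Λ(X)·R₀⟦T⟧`; `degree_le_of_pow_le_natCard_torsionBy_selmerLayer`:
  the certificate reading `p^m ≤ #Sel_𝔭^Σ(K_j)[p] ⟹ m ≤ n`.
* §4 `layerDegreeCertificate`: the `p = 3`, `Σ = ∅` instance with the crux's binders (as g5's
  `baseLayerDegreeCertificate`, now `∀ j`), and `degree_le_of_pow_le_natCard_layer` (the tier-`m` certificate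
  over `K_j`; `j = 1` is the sextic layer utd-idea g25 §2b names for tier `m′ = 2`).

HONEST STATUS. Pure control algebra on the tree's CONSTRUCTED objects; «`Λ`-torsion» and «no non-zero finite
`Λ`-submodule» are hypotheses, not discharged (cf. p637731's header: LMX Lemma 3.4 by name on `Σ₀`, nothing printed
for `Σ = ∅`); the bound `p^n` is the same at every layer (no `Σ_i min(a_i, p^j)` refinement is claimed). Nothing
here proves ♭B′, ♭B′°, ♭C₀_T or any class of BSD. References: [GreenbergLNM1716] §3 Lemma 3.1 (p. 86);
[GreenbergVatsal2000] §2 Prop. (2.8); [Washington1997] §13.2; [Castella2018] Def. 2.2.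
-/

set_option autoImplicit false
-- `…BirchSwinnertonDyer.BirchSwinnertonDyer.Theorems…` is the problem's mandated namespace (D-0017).
set_option linter.dupNamespace false

noncomputable section

open scoped Classical AddSubgroup

namespace Summit.BirchSwinnertonDyer.BirchSwinnertonDyer.Theorems.UniversalToricDescentLayerDegreeCertificate

open NumberField IsDedekindDomain Field
open Literature.NumberTheory.EllipticCurves Literature.NumberTheory.EllipticCurves.IwasawaAlgebra
  Literature.NumberTheory.EllipticCurves.GreenbergSelmer Literature.NumberTheory.EllipticCurves.Rank1Residual
  Literature.NumberTheory.GaloisRepresentations WeierstrassCurve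
  Summit.BirchSwinnertonDyer.Rank1Residual.X11b Summit.BirchSwinnertonDyer.Rank1Residual.X11b.AcSelmer
  Summit.BirchSwinnertonDyer.BirchSwinnertonDyer.Theorems.UniversalToricDescentAcDualMuZero
  Summit.BirchSwinnertonDyer.BirchSwinnertonDyer.Theorems.UniversalToricDescentLambdaTransport
  Summit.BirchSwinnertonDyer.BirchSwinnertonDyer.Theorems.UniversalToricDescentLambdaNormProfile
  Summit.BirchSwinnertonDyer.BirchSwinnertonDyer.Theorems.UniversalToricDescentBaseLayerDegreeCertificate

/-! ### §1 Every layer injects into the top layer on `p`-torsion -/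

section Generic

variable {K : Type} [Field K] [NumberField K]
  (W : WeierstrassCurve K) [W.IsElliptic] (p : ℕ) [Fact p.Prime] (κ : ZpExtension K p)
  (𝔭 : HeightOneSpectrum (𝓞 K)) (S : Set (HeightOneSpectrum (𝓞 K)))

omit [W.IsElliptic] in
/-- **Greenberg's Lemma 3.1 at level `j` with `B = 0`: `h_j : H¹(K_j, E[p^∞]) → H¹(K_∞, E[p^∞])` is injective
for every `j` when `E(K_∞)[p^∞] = E[p^∞]^{Gal(K̄/K_∞)} = 0`.** The tree's
`WeierstrassCurve.finite_ker_layerToInfty_and_card_le` embeds `ker h_j` into `B/(γ^{p^j} − 1)B`, a quotient of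
`B = 0`. [cite: GreenbergLNM1716, §3 Lemma 3.1 (p. 86)] -/
theorem layerToInfty_injective_of_fixedPoints_eq_bot {γ : absoluteGaloisGroup K} (hγ : κ.IsTopGenerator γ)
    (hB : FixedPoints.addSubgroup κ.kerSubgroup (W.geomPrimaryTorsion p) = ⊥) (j : ℕ) :
    Function.Injective (W.layerToInfty κ j) := by
  -- `B/(γ^{p^j} - 1)B` is a quotient of `B = ⊥`: at most one element
  haveI hsub : Subsingleton (FixedPoints.addSubgroup κ.kerSubgroup (W.geomPrimaryTorsion p)) := by
    rw [hB]; infer_instance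
  haveI hfinQ : Finite (FixedPoints.addSubgroup κ.kerSubgroup (W.geomPrimaryTorsion p) ⧸
      (ResKernel.subOne κ.kerSubgroup (W.geomPrimaryTorsion p) (γ ^ p ^ j)).range) :=
    Finite.of_surjective _ (QuotientAddGroup.mk'_surjective _)
  have hcardQ : Nat.card (FixedPoints.addSubgroup κ.kerSubgroup (W.geomPrimaryTorsion p) ⧸
      (ResKernel.subOne κ.kerSubgroup (W.geomPrimaryTorsion p) (γ ^ p ^ j)).range) ≤ 1 := by
    rw [Finite.card_le_one_iff_subsingleton]
    refine ⟨fun a b ↦ ?_⟩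
    obtain ⟨a, rfl⟩ := QuotientAddGroup.mk'_surjective _ a
    obtain ⟨b, rfl⟩ := QuotientAddGroup.mk'_surjective _ b
    rw [Subsingleton.elim a b]
  obtain ⟨hfin, hle⟩ := W.finite_ker_layerToInfty_and_card_le κ hγ j
  haveI := hfin
  haveI : Subsingleton (W.layerToInfty κ j).ker :=
    Finite.card_le_one_iff_subsingleton.mp (hle.trans hcardQ)
  rw [← AddMonoidHom.ker_eq_bot_iff]
  exact (W.layerToInfty κ j).ker.eq_bot_of_subsingleton

omit [W.IsElliptic] in
/-- **`#Sel_𝔭^Σ(K_j, E[p^∞])[p] ≤ #Sel_𝔭^Σ(K_∞, E[p^∞])[p]` when `h_j` is injective** and the right-hand side is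
finite: `h_j = res_{K_j → K_∞}` carries Castella's Selmer group over `K_j`
(`AcSelmer.selmerOver (κ.layerSubgroup j) …`) into the one over `K_∞` (`resOfLe_mem_selmerOver`) and `p`-torsion
to `p`-torsion. [cite: GreenbergLNM1716, §3 Lemma 3.1 (p. 86)] [cite: Castella2018, Def. 2.2 (arXiv:1704.06608 p. 5)] -/
theorem natCard_torsionBy_selmerLayer_le_of_injective (j : ℕ)
    (hinj : Function.Injective (W.layerToInfty κ j))
    [Finite {s : selmerAc W p κ 𝔭 S // p • s = 0}] :
    Nat.card ((selmerOver (κ.layerSubgroup j) (W.geomPrimaryTorsion p) p 𝔭 S)[(p : ℤ)]) ≤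
      Nat.card {s : selmerAc W p κ 𝔭 S // p • s = 0} := by
  let f : (selmerOver (κ.layerSubgroup j) (W.geomPrimaryTorsion p) p 𝔭 S)[(p : ℤ)] →
      {s : selmerAc W p κ 𝔭 S // p • s = 0} := fun c ↦
    ⟨⟨W.layerToInfty κ j ((c : selmerOver (κ.layerSubgroup j) (W.geomPrimaryTorsion p) p 𝔭 S) :
        W.subgroupH1 p (κ.layerSubgroup j)),
      resOfLe_mem_selmerOver (κ.kerSubgroup_le_layerSubgroup j)
        (c : selmerOver (κ.layerSubgroup j) (W.geomPrimaryTorsion p) p 𝔭 S).2⟩, by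
      have hc : p • (c : selmerOver (κ.layerSubgroup j) (W.geomPrimaryTorsion p) p 𝔭 S) = 0 :=
        AddSubgroup.torsionBy.nsmul_iff.mp c.2
      refine Subtype.ext ?_
      change p • W.layerToInfty κ j
        ((c : selmerOver (κ.layerSubgroup j) (W.geomPrimaryTorsion p) p 𝔭 S) :
          W.subgroupH1 p (κ.layerSubgroup j)) = 0
      rw [← map_nsmul, ← AddSubgroupClass.coe_nsmul, hc]
      exact map_zero _⟩
  refine Nat.card_le_card_of_injective f fun a b hab ↦ ?_
  have h1 : W.layerToInfty κ j
      ((a : selmerOver (κ.layerSubgroup j) (W.geomPrimaryTorsion p) p 𝔭 S) :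
        W.subgroupH1 p (κ.layerSubgroup j)) =
      W.layerToInfty κ j
      ((b : selmerOver (κ.layerSubgroup j) (W.geomPrimaryTorsion p) p 𝔭 S) :
        W.subgroupH1 p (κ.layerSubgroup j)) :=
    congrArg Subtype.val (congrArg Subtype.val hab)
  exact Subtype.ext (Subtype.ext (hinj h1))

/-- **`#Sel_𝔭^Σ(K_j, E[p^∞])[p] ≤ p^{λ(X_ac^Σ)}` for every `j`** when `E(K_∞)[p^∞] = 0`, `Σ` is finite and
`X = X_ac^Σ(E[p^∞])` is `Λ`-torsion with `μ(X) = 0` and without non-zero finite `Λ`-submodule: the top layer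
has exactly `p^{λ(X)}` classes killed by `p` (`pow_lambdaInvariant_eq_natCard_selmerAc_pTorsion`) and §1.
[cite: GreenbergVatsal2000, §2 Prop. (2.8) (proof, p. 27)] [cite: GreenbergLNM1716, §3 Lemma 3.1 (p. 86)] -/
theorem natCard_torsionBy_selmerLayer_le_pow_lambdaInvariant_of_fixedPoints_eq_bot
    (γ : absoluteGaloisGroup K) [hγ : Fact (κ.IsTopGenerator γ)] (hS : S.Finite)
    (hB : FixedPoints.addSubgroup κ.kerSubgroup (W.geomPrimaryTorsion p) = ⊥)
    (hT : Module.IsTorsion (IwasawaAlgebra p) (XAc W p κ 𝔭 S γ))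
    (hμ : muInvariant p (XAc W p κ 𝔭 S γ) = 0)
    (hnf : ∀ N : Submodule (IwasawaAlgebra p) (XAc W p κ 𝔭 S γ), Finite N → N = ⊥) (j : ℕ) :
    Nat.card ((selmerOver (κ.layerSubgroup j) (W.geomPrimaryTorsion p) p 𝔭 S)[(p : ℤ)]) ≤
      p ^ lambdaInvariant p (XAc W p κ 𝔭 S γ) := by
  haveI := finite_selmerAc_pTorsion_of_noFiniteSubmodule W p κ 𝔭 S γ hS hT hμ hnf
  rw [pow_lambdaInvariant_eq_natCard_selmerAc_pTorsion W p κ 𝔭 S γ hS hT hμ hnf]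
  exact natCard_torsionBy_selmerLayer_le_of_injective W p κ 𝔭 S j
    (layerToInfty_injective_of_fixedPoints_eq_bot W p κ hγ.out hB j)

end Generic

/-! ### §2 `E/ℚ` with `E[p]` irreducible, base-changed to a quadratic field: every layer -/

section Quadratic

variable (W : WeierstrassCurve ℚ) [W.IsElliptic] (p : ℕ) [Fact p.Prime]
  (K : Type) [Field K] [NumberField K] (κ : ZpExtension K p)
  (𝔭 : HeightOneSpectrum (𝓞 K)) (S : Set (HeightOneSpectrum (𝓞 K)))

/-- **`h_j : H¹(K_j, E[p^∞]) ↪ H¹(K_∞, E[p^∞])` for every `j`**, for `E/ℚ` with `E[p]` irreducible base-changed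
to a quadratic `K` and ANY `ℤ_p`-extension (`E(K_∞)[p^∞] = 0`: w2 g5's
`fixedPoints_kerSubgroup_baseChange_eq_bot_of_irr`). [cite: GreenbergLNM1716, §3 Lemma 3.1 (p. 86)] -/
theorem layerToInfty_baseChange_injective_of_irr {γ : absoluteGaloisGroup K} (hγ : κ.IsTopGenerator γ)
    (hirr : Irr W p) (hK : Module.finrank ℚ K = 2) (j : ℕ) :
    Function.Injective ((W.baseChange K).layerToInfty κ j) :=
  layerToInfty_injective_of_fixedPoints_eq_bot (W.baseChange K) p κ hγ
    (fixedPoints_kerSubgroup_baseChange_eq_bot_of_irr W p K κ hirr hK) j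

/-- **§2 main: `#Sel_𝔭^Σ(K_j, E[p^∞])[p] ≤ p^{λ(X_ac^Σ(E_K))}` for EVERY layer `j`**, for `E/ℚ` with `E[p]`
irreducible, `K` quadratic, ANY `ℤ_p`-extension `κ` with topological generator `γ`, any `𝔭` and finite `Σ`,
whenever `X_ac^Σ(E_K)` is `Λ`-torsion with `μ = 0` and has no non-zero finite `Λ`-submodule.
[cite: GreenbergVatsal2000, §2 Prop. (2.8) (proof, p. 27)] [cite: GreenbergLNM1716, §3 Lemma 3.1 (p. 86)] -/
theorem natCard_torsionBy_selmerLayer_le_pow_lambdaInvariant (γ : absoluteGaloisGroup K)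
    [Fact (κ.IsTopGenerator γ)] (hirr : Irr W p) (hK : Module.finrank ℚ K = 2) (hS : S.Finite)
    (hT : Module.IsTorsion (IwasawaAlgebra p) (XAc (W.baseChange K) p κ 𝔭 S γ))
    (hμ : muInvariant p (XAc (W.baseChange K) p κ 𝔭 S γ) = 0)
    (hnf : ∀ N : Submodule (IwasawaAlgebra p) (XAc (W.baseChange K) p κ 𝔭 S γ), Finite N → N = ⊥)
    (j : ℕ) :
    Nat.card ((selmerOver (κ.layerSubgroup j) ((W.baseChange K).geomPrimaryTorsion p) p 𝔭 S)[(p : ℤ)]) ≤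
      p ^ lambdaInvariant p (XAc (W.baseChange K) p κ 𝔭 S γ) :=
  natCard_torsionBy_selmerLayer_le_pow_lambdaInvariant_of_fixedPoints_eq_bot (W.baseChange K) p κ 𝔭 S γ hS
    (fixedPoints_kerSubgroup_baseChange_eq_bot_of_irr W p K κ hirr hK) hT hμ hnf j

/-! ### §3 The bound in the route's currency (profile index of a generator of `Ch_Λ(X)·R₀⟦T⟧`) -/

/-- **`#Sel_𝔭^Σ(K_j, E[p^∞])[p] ≤ p^n` at every layer `j`, `n` the norm-profile index of ANY generator `g` of
`Ch_Λ(X_ac^Σ(E_K))·R₀⟦T⟧`** (`‖g_i‖ < 1` for `i < n`, `‖g_n‖ = 1`; then `μ = 0` and `λ = n`), `X` torsion without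
non-zero finite `Λ`-submodule, `E[p]` irreducible, `K` quadratic, finite `Σ`.
[cite: Washington1997, §13.2 and §7.1] [cite: GreenbergVatsal2000, p. 2, (1)–(2)] -/
theorem natCard_torsionBy_selmerLayer_le_pow_of_generator_normProfile (γ : absoluteGaloisGroup K)
    [Fact (κ.IsTopGenerator γ)] (hirr : Irr W p) (hK : Module.finrank ℚ K = 2) (hS : S.Finite)
    (hT : Module.IsTorsion (IwasawaAlgebra p) (XAc (W.baseChange K) p κ 𝔭 S γ))
    (hnf : ∀ N : Submodule (IwasawaAlgebra p) (XAc (W.baseChange K) p κ 𝔭 S γ), Finite N → N = ⊥)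
    {g : UnrSeries p} {n : ℕ}
    (hg : (XAc.charIdeal (W.baseChange K) p κ 𝔭 S γ).map (PowerSeries.map (Halves.toUnr p)) =
      Ideal.span {g})
    (hgn : (∀ i < n, ‖((PowerSeries.coeff i g : unrIntegers p) : ℂ_[p])‖ < 1) ∧
      ‖((PowerSeries.coeff n g : unrIntegers p) : ℂ_[p])‖ = 1) (j : ℕ) :
    Nat.card ((selmerOver (κ.layerSubgroup j) ((W.baseChange K).geomPrimaryTorsion p) p 𝔭 S)[(p : ℤ)]) ≤
      p ^ n := by
  haveI := XAc.module_finite κ 𝔭 S γ hS (W := W.baseChange K)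
  have hμ : muInvariant p (XAc (W.baseChange K) p κ 𝔭 S γ) = 0 :=
    muInvariant_eq_zero_of_map_charIdeal_eq_span (XAc (W.baseChange K) p κ 𝔭 S γ) hT hg ⟨n, hgn.2⟩
  have hlam : lambdaInvariant p (XAc (W.baseChange K) p κ 𝔭 S γ) = n :=
    lambdaInvariant_eq_of_generator_normProfile (W.baseChange K) p κ 𝔭 S γ hS hT hμ hg hgn
  rw [← hlam]
  exact natCard_torsionBy_selmerLayer_le_pow_lambdaInvariant W p K κ 𝔭 S γ hirr hK hS hT hμ hnf j

/-- **The layer certificate, contrapositive reading**: an observed `p^m ≤ #Sel_𝔭^Σ(K_j, E[p^∞])[p]` at SOME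
layer `j` (e.g. `m` independent classes exhibited by a `p`-descent over the number field `K_j` with Castella's
local conditions) certifies `m ≤ n`. [cite: GreenbergVatsal2000, §2 Prop. (2.8)] -/
theorem degree_le_of_pow_le_natCard_torsionBy_selmerLayer (γ : absoluteGaloisGroup K)
    [Fact (κ.IsTopGenerator γ)] (hirr : Irr W p) (hK : Module.finrank ℚ K = 2) (hS : S.Finite)
    (hT : Module.IsTorsion (IwasawaAlgebra p) (XAc (W.baseChange K) p κ 𝔭 S γ))
    (hnf : ∀ N : Submodule (IwasawaAlgebra p) (XAc (W.baseChange K) p κ 𝔭 S γ), Finite N → N = ⊥)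
    {g : UnrSeries p} {n : ℕ}
    (hg : (XAc.charIdeal (W.baseChange K) p κ 𝔭 S γ).map (PowerSeries.map (Halves.toUnr p)) =
      Ideal.span {g})
    (hgn : (∀ i < n, ‖((PowerSeries.coeff i g : unrIntegers p) : ℂ_[p])‖ < 1) ∧
      ‖((PowerSeries.coeff n g : unrIntegers p) : ℂ_[p])‖ = 1)
    {j m : ℕ}
    (hobs : p ^ m ≤
      Nat.card ((selmerOver (κ.layerSubgroup j) ((W.baseChange K).geomPrimaryTorsion p) p 𝔭 S)[(p : ℤ)])) :
    m ≤ n :=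
  (Nat.pow_le_pow_iff_right (Fact.out : p.Prime).one_lt).mp
    (hobs.trans (natCard_torsionBy_selmerLayer_le_pow_of_generator_normProfile W p K κ 𝔭 S γ hirr hK hS hT
      hnf hg hgn j))

end Quadratic

/-! ### §4 The `p = 3`, `Σ = ∅` instance with the crux's binders, at every layer -/

/-- **Layer degree certificate at `p = 3`** (g5's `baseLayerDegreeCertificate` lifted to every layer `K_j`): for the
twin's `X′ = X_ac(W′_K; slot 𝔭′, Σ = ∅)`, `ρ̄_{W′,3}` onto, `K` imaginary quadratic, `κ` an anticyclotomic
`ℤ₃`-extension with topological generator `γ`, `𝔭′ ∋ 3`: if `X′` is `Λ`-torsion without non-zero finite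
`Λ`-submodule and `Ch(X′)·R₀⟦T⟧ = (g)` with profile index `n`, then `#Sel_{𝔭′}(K_j, W′[3^∞])[3] ≤ 3^n` for EVERY
`j` (the binders «anticyclotomic» and «`𝔭′ ∋ 3`» are the crux's and idle here).
[cite: GreenbergVatsal2000, §2 Prop. (2.8) (proof, p. 27)] [cite: GreenbergLNM1716, §3 Lemma 3.1 (p. 86)] -/
theorem layerDegreeCertificate :
    ∀ (W' : WeierstrassCurve ℚ) [W'.IsElliptic] [W'.IsGloballyMinimal] (K : Type) [Field K] [NumberField K],
      W'.HasSurjectiveModNGaloisRep 3 → IsImaginaryQuadratic K →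
      ∀ (κ : ZpExtension K 3), κ.IsAnticyclotomic →
      ∀ (γ : Field.absoluteGaloisGroup K) [Fact (κ.IsTopGenerator γ)]
        (𝔭' : HeightOneSpectrum (𝓞 K)), ((3 : ℕ) : 𝓞 K) ∈ 𝔭'.asIdeal →
      Module.IsTorsion (IwasawaAlgebra 3) (XAc (W'.baseChange K) 3 κ 𝔭' ∅ γ) →
      (∀ N : Submodule (IwasawaAlgebra 3) (XAc (W'.baseChange K) 3 κ 𝔭' ∅ γ), Finite N → N = ⊥) →
      ∀ (g : UnrSeries 3) (n : ℕ),
        (XAc.charIdeal (W'.baseChange K) 3 κ 𝔭' ∅ γ).map (PowerSeries.map (Halves.toUnr 3)) =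
          Ideal.span {g} →
        ((∀ i < n, ‖((PowerSeries.coeff i g : unrIntegers 3) : ℂ_[3])‖ < 1) ∧
          ‖((PowerSeries.coeff n g : unrIntegers 3) : ℂ_[3])‖ = 1) →
        ∀ j : ℕ,
          Nat.card ((selmerOver (κ.layerSubgroup j) ((W'.baseChange K).geomPrimaryTorsion 3) 3 𝔭' ∅)[((3 : ℕ) : ℤ)]) ≤
            3 ^ n := by
  intro W' _ _ K _ _ hsurj hK κ _ γ _ 𝔭' _ hT hnf g n hg hgn j
  haveI : Fact (Nat.Prime 3) := ⟨Nat.prime_three⟩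
  have hirr : Irr W' 3 := hasIrreducibleModPGaloisRep_of_hasSurjectiveModNGaloisRep W' 3 hsurj
  exact natCard_torsionBy_selmerLayer_le_pow_of_generator_normProfile W' 3 K κ 𝔭' ∅ γ hirr hK.1
    Set.finite_empty hT hnf hg hgn j

/-- **The layer certificate at `p = 3` in use**: under the binders of `layerDegreeCertificate`, an explicit
`3`-descent over the layer `K_j` (for `j = 1`: the sextic field `K₁`) exhibiting `3^m ≤ #Sel_{𝔭′}(K_j, W′[3^∞])[3]`
certifies `m ≤ n` — tier `m` of the degree clause `λ(𝓛′) ≤ λ(Ch X′)` of ♭B′° / ♭C₀° for that class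
(utd-idea g25 §2b: tiers `m′ ≥ 2` beyond the number of cyclic factors visible over `K`).
[cite: GreenbergVatsal2000, §2 Prop. (2.8)] -/
theorem degree_le_of_pow_le_natCard_layer
    (W' : WeierstrassCurve ℚ) [W'.IsElliptic] [W'.IsGloballyMinimal] (K : Type) [Field K] [NumberField K]
    (hsurj : W'.HasSurjectiveModNGaloisRep 3) (hK : IsImaginaryQuadratic K) (κ : ZpExtension K 3)
    (γ : Field.absoluteGaloisGroup K) [Fact (κ.IsTopGenerator γ)] (𝔭' : HeightOneSpectrum (𝓞 K))
    (hT : Module.IsTorsion (IwasawaAlgebra 3) (XAc (W'.baseChange K) 3 κ 𝔭' ∅ γ))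
    (hnf : ∀ N : Submodule (IwasawaAlgebra 3) (XAc (W'.baseChange K) 3 κ 𝔭' ∅ γ), Finite N → N = ⊥)
    {g : UnrSeries 3} {n : ℕ}
    (hg : (XAc.charIdeal (W'.baseChange K) 3 κ 𝔭' ∅ γ).map (PowerSeries.map (Halves.toUnr 3)) =
      Ideal.span {g})
    (hgn : (∀ i < n, ‖((PowerSeries.coeff i g : unrIntegers 3) : ℂ_[3])‖ < 1) ∧
      ‖((PowerSeries.coeff n g : unrIntegers 3) : ℂ_[3])‖ = 1)
    {j m : ℕ}
    (hobs : 3 ^ m ≤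
      Nat.card ((selmerOver (κ.layerSubgroup j) ((W'.baseChange K).geomPrimaryTorsion 3) 3 𝔭' ∅)[((3 : ℕ) : ℤ)])) :
    m ≤ n := by
  haveI : Fact (Nat.Prime 3) := ⟨Nat.prime_three⟩
  have hirr : Irr W' 3 := hasIrreducibleModPGaloisRep_of_hasSurjectiveModNGaloisRep W' 3 hsurj
  exact degree_le_of_pow_le_natCard_torsionBy_selmerLayer W' 3 K κ 𝔭' ∅ γ hirr hK.1 Set.finite_empty hT hnf
    hg hgn hobs

end Summit.BirchSwinnertonDyer.BirchSwinnertonDyer.Theorems.UniversalToricDescentLayerDegreeCertificate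

end
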